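import Summits.PneNP.PneNP.Theses.MonochromaticLines
import Literature.Computability.QuantumComplexity.ForrelationCircuitCode
import Literature.Computability.Complexity.CodeFPArith
import Literature.Computability.Complexity.CodeFPStrings
import Literature.Computability.Complexity.CodeFPLists
import Literature.Computability.Complexity.FoldBricks
import Literature.Computability.Complexity.PRelHierarchy
import Literature.Computability.Complexity.PromiseProofs

/-!
# Route MonochromaticLines — `MonoLineCheckable` (stmt-PneNP-11759)

Solutions of the monochromatic-line search problem are polynomial-time checkable: ONE typed `CodeFP` test on
`((1ⁿ, [circuit codes]), w)` decodes `w = ⟨bin x, ⟨bin y, bin z⟩⟩` (`decodeNat` via `canonF`), checks that `x, y, z < 3ⁿ`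
are pairwise distinct with digit sums `≡ 0 (mod 3)`, computes the `2n` trit-indicator bits of `x, y, z` and compares
the values of every listed circuit on them with the evaluator of `ForrelationCircuitCode` (the instance code of the
route IS Forrelation's `encodeCircuit`, gate list of truth tables and wire codes). The language is the preimage of
`HeadIs true` under the program; the claimed `iff` only concerns codes of genuine instances, so no code recognition is
needed.
-/

set_option linter.dupNamespace false -- `Summit.PneNP.PneNP.…`: summit = sub-problem name (D-0017 single-conjunct layout)

namespace Summit.PneNP.PneNP.Theorems

open _root_.Computability
open Literature.Computability.Complexity Literature.Computability.Complexity.CodeFP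
  Literature.Computability.Complexity.Brick
open Literature.Computability.QuantumComplexity Literature.Computability.QuantumComplexity.ForrCode

/-- `decodeNat` is computed on codes (through the canonical binary form `canonF`). [folklore] -/
theorem monoLine_codeFP_decodeNat : CodeFP strE natE fun w : List Bool => decodeNat w :=
  CodeFP.of_fn canonF canonF_mem_FP fun w => canonF_eq_encodeNat_decodeNat w

/-- **The typed solution test and its specification.** On `((n, cs), w)`: the line conditions on
`(x, y, z) = (decodeNat (fstF w), decodeNat (fstF (sndF w)), decodeNat (sndF (sndF w)))` and equality of the values
of every circuit of `cs` on the trit-indicator bit lists of `x, y` and of `y, z`. [cite: AroraBarakCC2009, §1.3] [folklore] -/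
theorem monoLine_exists_codeTest :
    ∃ τ : (ℕ × List PCirc) × List Bool → Bool, CodeFP (pairE (pairE unE (rawE pcE)) strE) bitE τ ∧
      ∀ (n : ℕ) (cs : List PCirc) (w : List Bool), τ ((n, cs), w) = true ↔
        ((decodeNat (fstF w) < 3 ^ n ∧ decodeNat (fstF (sndF w)) < 3 ^ n ∧ decodeNat (sndF (sndF w)) < 3 ^ n ∧
          decodeNat (fstF w) ≠ decodeNat (fstF (sndF w)) ∧ decodeNat (fstF (sndF w)) ≠ decodeNat (sndF (sndF w)) ∧
          decodeNat (fstF w) ≠ decodeNat (sndF (sndF w)) ∧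
          ∀ l, l < n → (decodeNat (fstF w) / 3 ^ l % 3 + decodeNat (fstF (sndF w)) / 3 ^ l % 3 +
            decodeNat (sndF (sndF w)) / 3 ^ l % 3) % 3 = 0) ∧
        ∀ c ∈ cs,
          evalP c ((List.range (2 * n)).map fun i => decide (decodeNat (fstF w) / 3 ^ (i / 2) % 3 = i % 2 + 1)) =
            evalP c ((List.range (2 * n)).map fun i => decide (decodeNat (fstF (sndF w)) / 3 ^ (i / 2) % 3 = i % 2 + 1)) ∧
          evalP c ((List.range (2 * n)).map fun i => decide (decodeNat (fstF (sndF w)) / 3 ^ (i / 2) % 3 = i % 2 + 1)) =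
            evalP c ((List.range (2 * n)).map fun i => decide (decodeNat (sndF (sndF w)) / 3 ^ (i / 2) % 3 = i % 2 + 1))) := by
  have hfst : CodeFP strE strE fun w : List Bool => fstF w := CodeFP.of_fn fstF fstF_mem_FP fun _ => rfl
  have hsnd : CodeFP strE strE fun w : List Bool => sndF w := CodeFP.of_fn sndF sndF_mem_FP fun _ => rfl
  -- data on `t = ((n, cs), w)`
  have tn : CodeFP (pairE (pairE unE (rawE pcE)) strE) unE fun t : (ℕ × List PCirc) × List Bool => t.1.1 := (CodeFP.fst _ _).fst'
  have tcs : CodeFP (pairE (pairE unE (rawE pcE)) strE) (rawE pcE) fun t : (ℕ × List PCirc) × List Bool => t.1.2 :=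
    (CodeFP.fst _ _).snd'
  have tw : CodeFP (pairE (pairE unE (rawE pcE)) strE) strE fun t : (ℕ × List PCirc) × List Bool => t.2 := CodeFP.snd _ _
  have tx : CodeFP (pairE (pairE unE (rawE pcE)) strE) natE fun t : (ℕ × List PCirc) × List Bool => decodeNat (fstF t.2) :=
    (monoLine_codeFP_decodeNat.comp (hfst.comp tw) :)
  have ty : CodeFP (pairE (pairE unE (rawE pcE)) strE) natE
      fun t : (ℕ × List PCirc) × List Bool => decodeNat (fstF (sndF t.2)) := (monoLine_codeFP_decodeNat.comp (hfst.comp (hsnd.comp tw)) :)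
  have tz : CodeFP (pairE (pairE unE (rawE pcE)) strE) natE
      fun t : (ℕ × List PCirc) × List Bool => decodeNat (sndF (sndF t.2)) := (monoLine_codeFP_decodeNat.comp (hsnd.comp (hsnd.comp tw)) :)
  have t3n : CodeFP (pairE (pairE unE (rawE pcE)) strE) natE fun t : (ℕ × List PCirc) × List Bool => 3 ^ t.1.1 :=
    (natPow.comp ((CodeFP.const _ 3).pair tn) :)
  -- the digit test on `e = ((((x, y), z), n), l)`
  have ex : CodeFP (pairE (pairE (pairE (pairE natE natE) natE) unE) natE) natE fun e : (((ℕ × ℕ) × ℕ) × ℕ) × ℕ => e.1.1.1.1 :=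
    (CodeFP.fst _ _).fst'.fst'.fst'
  have ey : CodeFP (pairE (pairE (pairE (pairE natE natE) natE) unE) natE) natE fun e : (((ℕ × ℕ) × ℕ) × ℕ) × ℕ => e.1.1.1.2 :=
    (CodeFP.fst _ _).fst'.fst'.snd'
  have ez : CodeFP (pairE (pairE (pairE (pairE natE natE) natE) unE) natE) natE fun e : (((ℕ × ℕ) × ℕ) × ℕ) × ℕ => e.1.1.2 :=
    (CodeFP.fst _ _).fst'.snd'
  have en : CodeFP (pairE (pairE (pairE (pairE natE natE) natE) unE) natE) unE fun e : (((ℕ × ℕ) × ℕ) × ℕ) × ℕ => e.1.2 :=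
    (CodeFP.fst _ _).snd'
  have el : CodeFP (pairE (pairE (pairE (pairE natE natE) natE) unE) natE) natE fun e : (((ℕ × ℕ) × ℕ) × ℕ) × ℕ => e.2 :=
    CodeFP.snd _ _
  have ep : CodeFP (pairE (pairE (pairE (pairE natE natE) natE) unE) natE) natE
      fun e : (((ℕ × ℕ) × ℕ) × ℕ) × ℕ => 3 ^ min e.2 e.1.2 := (natPow.comp ((CodeFP.const _ 3).pair (unOfNatMin.comp (en.pair el))) :)
  have edig : ∀ {U : ((((ℕ × ℕ) × ℕ) × ℕ) × ℕ) → ℕ}, CodeFP (pairE (pairE (pairE (pairE natE natE) natE) unE) natE) natE U →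
      CodeFP (pairE (pairE (pairE (pairE natE natE) natE) unE) natE) natE fun e => U e / 3 ^ min e.2 e.1.2 % 3 :=
    fun hU => (natMod.comp ((natDiv.comp (hU.pair ep)).pair (CodeFP.const _ 3)) :)
  have esum : CodeFP (pairE (pairE (pairE (pairE natE natE) natE) unE) natE) bitE
      fun e : (((ℕ × ℕ) × ℕ) × ℕ) × ℕ => decide ((e.1.1.1.1 / 3 ^ min e.2 e.1.2 % 3 + e.1.1.1.2 / 3 ^ min e.2 e.1.2 % 3 +
        e.1.1.2 / 3 ^ min e.2 e.1.2 % 3) % 3 = 0) :=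
    (natEq.comp ((natMod.comp ((natAdd.comp ((natAdd.comp ((edig ex).pair (edig ey))).pair (edig ez))).pair
      (CodeFP.const _ 3))).pair (CodeFP.const _ 0)) :)
  have tdig : CodeFP (pairE (pairE unE (rawE pcE)) strE) bitE fun t : (ℕ × List PCirc) × List Bool =>
      (List.range t.1.1).all fun l => decide ((decodeNat (fstF t.2) / 3 ^ min l t.1.1 % 3 +
        decodeNat (fstF (sndF t.2)) / 3 ^ min l t.1.1 % 3 + decodeNat (sndF (sndF t.2)) / 3 ^ min l t.1.1 % 3) % 3 = 0) :=
    ((CodeFP.all esum).comp ((((tx.pair ty).pair tz).pair tn).pair (urange.comp tn)) :)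
  -- the line test
  have tline : CodeFP (pairE (pairE unE (rawE pcE)) strE) bitE fun t : (ℕ × List PCirc) × List Bool =>
      (decide (decodeNat (fstF t.2) < 3 ^ t.1.1) && (decide (decodeNat (fstF (sndF t.2)) < 3 ^ t.1.1) &&
        decide (decodeNat (sndF (sndF t.2)) < 3 ^ t.1.1))) &&
      ((!decide (decodeNat (fstF t.2) = decodeNat (fstF (sndF t.2))) && (!decide (decodeNat (fstF (sndF t.2)) =
        decodeNat (sndF (sndF t.2))) && !decide (decodeNat (fstF t.2) = decodeNat (sndF (sndF t.2))))) &&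
      (List.range t.1.1).all fun l => decide ((decodeNat (fstF t.2) / 3 ^ min l t.1.1 % 3 +
        decodeNat (fstF (sndF t.2)) / 3 ^ min l t.1.1 % 3 + decodeNat (sndF (sndF t.2)) / 3 ^ min l t.1.1 % 3) % 3 = 0)) :=
    by
    have c1 : CodeFP (pairE (pairE unE (rawE pcE)) strE) bitE fun t : (ℕ × List PCirc) × List Bool =>
        decide (decodeNat (fstF t.2) < 3 ^ t.1.1) := (natLt.comp (tx.pair t3n) :)
    have c2 : CodeFP (pairE (pairE unE (rawE pcE)) strE) bitE fun t : (ℕ × List PCirc) × List Bool =>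
        decide (decodeNat (fstF (sndF t.2)) < 3 ^ t.1.1) := (natLt.comp (ty.pair t3n) :)
    have c3 : CodeFP (pairE (pairE unE (rawE pcE)) strE) bitE fun t : (ℕ × List PCirc) × List Bool =>
        decide (decodeNat (sndF (sndF t.2)) < 3 ^ t.1.1) := (natLt.comp (tz.pair t3n) :)
    have c4 : CodeFP (pairE (pairE unE (rawE pcE)) strE) bitE fun t : (ℕ × List PCirc) × List Bool =>
        decide (decodeNat (fstF t.2) = decodeNat (fstF (sndF t.2))) := (natEq.comp (tx.pair ty) :)
    have c5 : CodeFP (pairE (pairE unE (rawE pcE)) strE) bitE fun t : (ℕ × List PCirc) × List Bool =>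
        decide (decodeNat (fstF (sndF t.2)) = decodeNat (sndF (sndF t.2))) := (natEq.comp (ty.pair tz) :)
    have c6 : CodeFP (pairE (pairE unE (rawE pcE)) strE) bitE fun t : (ℕ × List PCirc) × List Bool =>
        decide (decodeNat (fstF t.2) = decodeNat (sndF (sndF t.2))) := (natEq.comp (tx.pair tz) :)
    exact (c1.and (c2.and c3)).and ((c4.not.and (c5.not.and c6.not)).and tdig)
  -- the trit-indicator bits on `(v, n)`-data: `i ↦ [v / 3^{i/2} % 3 = i % 2 + 1]` over `range (2n)`
  have hbit : CodeFP (pairE (pairE natE unE) natE) bitE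
      fun q : (ℕ × ℕ) × ℕ => decide (q.1.1 / 3 ^ min (q.2 / 2) q.1.2 % 3 = q.2 % 2 + 1) := by
    have qv : CodeFP (pairE (pairE natE unE) natE) natE fun q : (ℕ × ℕ) × ℕ => q.1.1 := (CodeFP.fst _ _).fst'
    have qn : CodeFP (pairE (pairE natE unE) natE) unE fun q : (ℕ × ℕ) × ℕ => q.1.2 := (CodeFP.fst _ _).snd'
    have qi : CodeFP (pairE (pairE natE unE) natE) natE fun q : (ℕ × ℕ) × ℕ => q.2 := CodeFP.snd _ _
    have qh : CodeFP (pairE (pairE natE unE) natE) natE fun q : (ℕ × ℕ) × ℕ => q.2 / 2 := (natDiv.comp (qi.pair (CodeFP.const _ 2)) :)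
    have qp : CodeFP (pairE (pairE natE unE) natE) natE fun q : (ℕ × ℕ) × ℕ => 3 ^ min (q.2 / 2) q.1.2 :=
      (natPow.comp ((CodeFP.const _ 3).pair (unOfNatMin.comp (qn.pair qh))) :)
    have ql : CodeFP (pairE (pairE natE unE) natE) natE fun q : (ℕ × ℕ) × ℕ => q.1.1 / 3 ^ min (q.2 / 2) q.1.2 % 3 :=
      (natMod.comp ((natDiv.comp (qv.pair qp)).pair (CodeFP.const _ 3)) :)
    have qr : CodeFP (pairE (pairE natE unE) natE) natE fun q : (ℕ × ℕ) × ℕ => q.2 % 2 + 1 :=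
      (natAdd.comp ((natMod.comp (qi.pair (CodeFP.const _ 2))).pair (CodeFP.const _ 1)) :)
    exact (natEq.comp (ql.pair qr) :)
  have hbits : CodeFP (pairE natE unE) strE
      fun q : ℕ × ℕ => (List.range (2 * q.2)).map fun i => decide (q.1 / 3 ^ min (i / 2) q.2 % 3 = i % 2 + 1) := by
    have h2 : CodeFP (pairE natE unE) unE fun q : ℕ × ℕ => 2 * q.2 := by
      refine ((unAdd.comp ((CodeFP.snd _ _).pair (CodeFP.snd _ _)) :)).congr fun q => ?_
      show q.2 + q.2 = 2 * q.2
      ring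
    exact (bitsToStr.comp ((CodeFP.map hbit).comp ((CodeFP.id _).pair (urange.comp h2))) :)
  have txs : CodeFP (pairE (pairE unE (rawE pcE)) strE) strE fun t : (ℕ × List PCirc) × List Bool =>
      (List.range (2 * t.1.1)).map fun i => decide (decodeNat (fstF t.2) / 3 ^ min (i / 2) t.1.1 % 3 = i % 2 + 1) :=
    (hbits.comp (tx.pair tn) :)
  have tys : CodeFP (pairE (pairE unE (rawE pcE)) strE) strE fun t : (ℕ × List PCirc) × List Bool =>
      (List.range (2 * t.1.1)).map fun i => decide (decodeNat (fstF (sndF t.2)) / 3 ^ min (i / 2) t.1.1 % 3 = i % 2 + 1) :=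
    (hbits.comp (ty.pair tn) :)
  have tzs : CodeFP (pairE (pairE unE (rawE pcE)) strE) strE fun t : (ℕ × List PCirc) × List Bool =>
      (List.range (2 * t.1.1)).map fun i => decide (decodeNat (sndF (sndF t.2)) / 3 ^ min (i / 2) t.1.1 % 3 = i % 2 + 1) :=
    (hbits.comp (tz.pair tn) :)
  -- the circuit test on `r = (((xs, ys), zs), c)`
  have rxs : CodeFP (pairE (pairE (pairE strE strE) strE) pcE) strE fun r : ((List Bool × List Bool) × List Bool) × PCirc => r.1.1.1 :=
    (CodeFP.fst _ _).fst'.fst'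
  have rys : CodeFP (pairE (pairE (pairE strE strE) strE) pcE) strE fun r : ((List Bool × List Bool) × List Bool) × PCirc => r.1.1.2 :=
    (CodeFP.fst _ _).fst'.snd'
  have rzs : CodeFP (pairE (pairE (pairE strE strE) strE) pcE) strE fun r : ((List Bool × List Bool) × List Bool) × PCirc => r.1.2 :=
    (CodeFP.fst _ _).snd'
  have rc : CodeFP (pairE (pairE (pairE strE strE) strE) pcE) pcE fun r : ((List Bool × List Bool) × List Bool) × PCirc => r.2 :=
    CodeFP.snd _ _
  have rev : ∀ {U : (((List Bool × List Bool) × List Bool) × PCirc) → List Bool},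
      CodeFP (pairE (pairE (pairE strE strE) strE) pcE) strE U →
      CodeFP (pairE (pairE (pairE strE strE) strE) pcE) bitE fun r => evalP r.2 (U r) := fun hU => (evalP_codeFP.comp (rc.pair hU) :)
  have rtest : CodeFP (pairE (pairE (pairE strE strE) strE) pcE) bitE fun r : ((List Bool × List Bool) × List Bool) × PCirc =>
      decide (evalP r.2 r.1.1.1 = evalP r.2 r.1.1.2) && decide (evalP r.2 r.1.1.2 = evalP r.2 r.1.2) :=
    (((CodeFP.eq bitE_injective).comp ((rev rxs).pair (rev rys)) :)).and (((CodeFP.eq bitE_injective).comp ((rev rys).pair (rev rzs)) :))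
  have tcirc := ((CodeFP.all rtest).comp (((txs.pair tys).pair tzs).pair tcs) :)
  refine ⟨_, tline.and tcirc, fun n cs w => ?_⟩
  simp only [Bool.and_eq_true, decide_eq_true_eq, List.all_eq_true, Bool.not_eq_true',
    decide_eq_false_iff_not, List.mem_range]
  have hmin : ∀ v : ℕ, ((List.range (2 * n)).map fun i => decide (v / 3 ^ min (i / 2) n % 3 = i % 2 + 1)) =
      (List.range (2 * n)).map fun i => decide (v / 3 ^ (i / 2) % 3 = i % 2 + 1) := fun v => by
    refine List.map_congr_left fun i hi => ?_
    rw [List.mem_range] at hi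
    rw [min_eq_left (by omega)]
  rw [hmin, hmin, hmin]
  constructor
  · rintro ⟨⟨⟨h1, h2, h3⟩, ⟨h4, h5, h6⟩, h7⟩, h8⟩
    exact ⟨⟨h1, h2, h3, h4, h5, h6, fun l hl => by simpa [min_eq_left hl.le] using h7 l hl⟩, h8⟩
  · rintro ⟨⟨h1, h2, h3, h4, h5, h6, h7⟩, h8⟩
    exact ⟨⟨⟨h1, h2, h3⟩, ⟨h4, h5, h6⟩, fun l hl => by simpa [min_eq_left hl.le] using h7 l hl⟩, h8⟩

/-- Reading the trit-indicator bit list as a circuit input. [folklore] -/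
theorem monoLine_toInput_map_range (m : ℕ) (b : ℕ → Bool) :
    toInput m ((List.range m).map b) = fun i : Fin m => b i := by
  funext i
  rw [toInput, List.getD_eq_getElem _ _ (by simp)]
  simp

/-- **stmt-PneNP-11759** `MonoLineCheckable`: solutions of the monochromatic-line problem are checkable in polynomial
time. [cite: AroraBarakCC2009, §1.3 and §6.1] -/
theorem monochromaticLines_monoLineCheckable_proof : Summit.PneNP.PneNP.Theses.MonochromaticLines.MonoLineCheckable := by
  classical
  unfold Summit.PneNP.PneNP.Theses.MonochromaticLines.MonoLineCheckable
  intro IsLine col Valid dec SolStr wire code encI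
  obtain ⟨τ, ⟨g, hg, hgspec⟩, hspec⟩ := monoLine_exists_codeTest
  refine ⟨g ⁻¹' PRelSigma.HeadIs true, preimage_mem_P (PRelSigma.HeadIs_mem_P true) hg, fun I _ w => ?_⟩
  obtain ⟨n, C⟩ := I
  -- the instance code is the typed code of `(n, [pcircOf (C j)])`
  have hwire : ∀ (m : ℕ) (v : Fin m ⊕ ℕ), wire m v = encodeWire m v := fun m v => by cases v <;> rfl
  have hcode : ∀ j : Fin (n / 10), code (2 * n) (C j) = pcE (pcircOf (C j)) := fun j => by
    rw [← encodeCircuit_eq]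
    simp only [code, encodeCircuit, encodeCodeList, hwire]
    rfl
  have hlist : ((List.ofFn fun j : Fin (n / 10) => code (2 * n) (C j)).foldr boolPair []) =
      rawE pcE (List.ofFn fun j : Fin (n / 10) => pcircOf (C j)) := by
    rw [show (List.ofFn fun j : Fin (n / 10) => code (2 * n) (C j)) = List.ofFn fun j => pcE (pcircOf (C j)) from
      congrArg _ (funext hcode), ← encodeCodeList, encodeCodeList_eq_rawE]
    simp only [rawE, List.map_ofFn]
    rfl
  have hencI : boolPair (encI ⟨n, C⟩) w = pairE (pairE unE (rawE pcE)) strE ((n, List.ofFn fun j => pcircOf (C j)), w) := by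
    simp only [encI, pairE_apply, hlist]
    rfl
  rw [hencI]
  change g (pairE (pairE unE (rawE pcE)) strE ((n, List.ofFn fun j => pcircOf (C j)), w)) ∈ PRelSigma.HeadIs true ↔ _
  rw [PRelSigma.mem_HeadIs, hgspec]
  simp only [bitE, List.head?_cons, Option.some.injEq]
  rw [hspec]
  simp only [List.forall_mem_ofFn_iff, evalP_pcircOf_eq, monoLine_toInput_map_range, forall_and, fstF, sndF]
  simp only [SolStr, IsLine, dec, col, funext_iff]
  exact Iff.rfl

end Summit.PneNP.PneNP.Theorems
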